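import Summits.Ventures.PercRepro.S1TriangleQ2
import Summits.Ventures.PercRepro.S1CellQ

/-!
# PercRepro — the cell `(9, 16)` of the `q = 4` window, by LEMMA Q‴ (p2, gen 17)

With `s₃ ≤ cq2 16 = 57` (the table from the theorem `P(7) = 11`; LEMMA Q gave `70`) and `s₄ ≤ C(19, 4) = 3876`, the
capped cell inequality `cellOK10 9 16 57 3876` holds (twin `0.9744`): an `e`-free core of rank `9` with `25` points
satisfies `RLS` at level `4`.

* `cell_nine_sixteen_q2` — the kernel cell; **`c025_core_nine_sixteen`** — the core.
Axioms: standard.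
-/

open scoped Matroid

namespace PercRepro

namespace S1

open Set

variable {α : Type}

/-- The cell `(9, 16)` with `s₃ ≤ 57` (LEMMA Q‴) and `s₄ ≤ C(19, 4) = 3876`. -/
theorem cell_nine_sixteen_q2 : cellOK10 9 16 57 3876 = true := by decide +kernel

/-- **THE CELL `(9, 16)`**: an `e`-free core of rank `9` with `25` points satisfies `RLS` at level `4`. -/
theorem c025_core_nine_sixteen (M : Matroid α) [M.Finite] (hR : M.eRank = (9 : ℕ)) (hn : M.E.ncard = 25)
    (hfree : ∀ e ∈ M.E, ∃ A ⊆ M.E \ {e}, e ∉ M.closure A ∧ e ∉ M.closure ((M.E \ {e}) \ A)) :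
    ThmN.RLS M 9 4 := by
  have hd : M.E.encard = M.eRank + ((16 : ℕ) : ℕ∞) := by
    rw [hR, ← M.ground_finite.cast_ncard_eq, hn]
    push_cast
    ring
  have hP : {C : Set α | M.IsCircuit C ∧ C.ncard = 3}.ncard ≤ 57 := by
    have h := core_ncard_triangles_le_cq2 M hfree hd
    rwa [show cq2 16 = 57 by decide] at h
  have hS : {C : Set α | M.IsCircuit C ∧ C.ncard = 4}.ncard ≤ 3876 :=
    (ncard_fourCircuits_le_choose M hd).trans (by decide +kernel)
  exact rls_of_cellOK10 M 9 16 57 3876 (by norm_num) hR hn hfree hP hS (by norm_num) cell_nine_sixteen_q2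

end S1

end PercRepro
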